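import Mathlib.Tactic

/-!
# Signed refill law — kernel algebra (LINE 17 `kolyvagin_swap`, support toward SWα; g14)

Pure algebra behind the **signed refill law** at a Kolyvagin prime (card §v7.4):
in a hyperbolic plane `ℤg ⊕ ℤg'` (both lines isotropic, symmetric pairing, `B g g'` of
order `≥ 2^N`), a vector `m•g + n•g'` that is isotropic WITH ITSELF and has a big
`g'`-coordinate has a tiny `g`-coordinate (`isotropic_vector_fpart_small`), and a vector of
`ℤg'` orthogonal to a big vector of `ℤg` is tiny (`perp_tpart_small`).  The number-theoretic
core is `two_pow_dvd_of_dvd_two_mul`.  Nothing here is specific to elliptic curves; nothing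
here proves SWα, U1 or BSD.
-/

set_option linter.dupNamespace false

namespace Summit.BirchSwinnertonDyer.BirchSwinnertonDyer.Cruxes.KolyvaginBoundedDefectAtTwo.KolyvaginSwap.SignedRefill

/-- Core 2-adic bookkeeping: `2^N ∣ 2mn` and `2^(j+1) ∤ n` force `2^(N-j-1) ∣ m`. -/
theorem two_pow_dvd_of_dvd_two_mul :
    ∀ (j N : ℕ) (m n : ℤ), (2 : ℤ) ^ N ∣ 2 * m * n → ¬ (2 : ℤ) ^ (j + 1) ∣ n →
      (2 : ℤ) ^ (N - j - 1) ∣ m := by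
  intro j
  induction j with
  | zero =>
    intro N m n h hn
    rw [zero_add, pow_one] at hn
    cases N with
    | zero => simp
    | succ N' =>
      have h2 : (2 : ℤ) ^ N' ∣ m * n := by
        have : (2 : ℤ) * 2 ^ N' ∣ 2 * (m * n) := by
          rw [← pow_succ', ← mul_assoc]; exact h
        exact (mul_dvd_mul_iff_left two_ne_zero).mp this
      have h3 : (2 : ℤ) ^ N' ∣ m := Int.prime_two.pow_dvd_of_dvd_mul_right N' hn h2
      simpa using h3
  | succ j ih =>
    intro N m n h hn
    by_cases h2n : (2 : ℤ) ∣ n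
    · obtain ⟨n'', rfl⟩ := h2n
      have hn'' : ¬ (2 : ℤ) ^ (j + 1) ∣ n'' := by
        intro hd
        apply hn
        obtain ⟨c, hc⟩ := hd
        exact ⟨c, by rw [hc]; ring⟩
      cases N with
      | zero => simp
      | succ N' =>
        have h' : (2 : ℤ) ^ N' ∣ 2 * m * n'' := by
          have : (2 : ℤ) * 2 ^ N' ∣ 2 * (2 * m * n'') := by
            rw [← pow_succ']
            have e : (2 : ℤ) * (2 * m * n'') = 2 * m * (2 * n'') := by ring
            rw [e]; exact h
          exact (mul_dvd_mul_iff_left two_ne_zero).mp this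
        have := ih N' m n'' h' hn''
        have e : N' + 1 - (j + 1) - 1 = N' - j - 1 := by omega
        rw [e]; exact this
    · -- `n` odd: the full power goes into `m`
      cases N with
      | zero => simp
      | succ N' =>
        have h2 : (2 : ℤ) ^ N' ∣ m * n := by
          have : (2 : ℤ) * 2 ^ N' ∣ 2 * (m * n) := by
            rw [← pow_succ', ← mul_assoc]; exact h
          exact (mul_dvd_mul_iff_left two_ne_zero).mp this
        have h3 : (2 : ℤ) ^ N' ∣ m := Int.prime_two.pow_dvd_of_dvd_mul_right N' h2n h2
        exact dvd_trans (pow_dvd_pow 2 (by omega)) h3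

variable {A Q : Type*} [AddCommGroup A] [AddCommGroup Q]

/-- Cross term on a hyperbolic pair of lines. -/
theorem cross_pair (B : A →+ A →+ Q) (g g' : A) (m n : ℤ) :
    B (m • g) (n • g') = (m * n) • B g g' := by
  rw [map_zsmul B m g, AddMonoidHom.zsmul_apply, map_zsmul, smul_smul, mul_comm]

/-- Self-pairing of `m•g + n•g'` for a SYMMETRIC pairing with `g`, `g'` isotropic:
it is `2mn • B g g'`. -/
theorem self_pair (B : A →+ A →+ Q) (hsymm : ∀ x y, B x y = B y x) (g g' : A)
    (hg : B g g = 0) (hg' : B g' g' = 0) (m n : ℤ) :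
    B (m • g + n • g') (m • g + n • g') = (2 * m * n) • B g g' := by
  have h1 : B (m • g) (m • g) = 0 := by rw [cross_pair, hg, smul_zero]
  have h2 : B (n • g') (n • g') = 0 := by rw [cross_pair, hg', smul_zero]
  have h3 : B (m • g) (n • g') = (m * n) • B g g' := cross_pair B g g' m n
  have h4 : B (n • g') (m • g) = (m * n) • B g g' := by rw [hsymm]; exact h3
  have e : B (m • g + n • g') (m • g + n • g')
      = B (m • g) (m • g) + B (n • g') (m • g) + (B (m • g) (n • g') + B (n • g') (n • g')) := by
    simp only [map_add, AddMonoidHom.add_apply]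
  rw [e, h1, h2, h3, h4, zero_add, add_zero, ← add_smul]
  congr 1; ring

/-- A multiple `m • g` with `2^d ∣ m` is killed by `2^(M-d)` when `2^M` kills `g`. -/
theorem smul_killed_of_two_pow_dvd (g : A) (M d : ℕ) (hgM : ((2 : ℤ) ^ M) • g = 0)
    (hd : d ≤ M) (m : ℤ) (hm : (2 : ℤ) ^ d ∣ m) :
    ((2 : ℤ) ^ (M - d)) • (m • g) = 0 := by
  obtain ⟨m', rfl⟩ := hm
  rw [smul_smul]
  have e : (2 : ℤ) ^ (M - d) * (2 ^ d * m') = m' * 2 ^ M := by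
    rw [← mul_assoc, ← pow_add, Nat.sub_add_cancel hd]; ring
  rw [e, mul_smul, hgM, smul_zero]

/-- **Isotropic vectors have a tiny finite part when their transverse part is big.**
Hyperbolic pair of isotropic lines `ℤg`, `ℤg'`, symmetric pairing whose cross value
`B g g'` has order at least `2^N` (`hw`), `2^M g = 0`.  If `x = m•g + n•g'` pairs to zero
with itself and its `g'`-coordinate is big (`2^(j+1) ∤ n`), then its `g`-part `m•g` is
killed by `2^(M+j+1-N)`. -/
theorem isotropic_vector_fpart_small (B : A →+ A →+ Q) (hsymm : ∀ x y, B x y = B y x)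
    (g g' : A) (hg : B g g = 0) (hg' : B g' g' = 0) (N M j : ℕ)
    (hw : ∀ t : ℤ, t • B g g' = 0 → (2 : ℤ) ^ N ∣ t) (hgM : ((2 : ℤ) ^ M) • g = 0)
    (hle : N - j - 1 ≤ M) (m n : ℤ) (hx : B (m • g + n • g') (m • g + n • g') = 0)
    (hn : ¬ (2 : ℤ) ^ (j + 1) ∣ n) :
    ((2 : ℤ) ^ (M - (N - j - 1))) • (m • g) = 0 := by
  rw [self_pair B hsymm g g' hg hg'] at hx
  have hdiv : (2 : ℤ) ^ N ∣ 2 * m * n := hw _ hx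
  exact smul_killed_of_two_pow_dvd g M (N - j - 1) hgM hle m
    (two_pow_dvd_of_dvd_two_mul j N m n hdiv hn)

/-- **Orthogonal to a big finite vector ⇒ tiny transverse vector.**  Same hyperbolic pair;
if `m•g` is big (`2^(a+1) ∤ m`) and `B (m•g) (n•g') = 0`, then `n•g'` is killed by
`2^(M'+a+1-N)` (`2^M' g' = 0`). -/
theorem perp_tpart_small (B : A →+ A →+ Q) (g g' : A) (N M' a : ℕ)
    (hw : ∀ t : ℤ, t • B g g' = 0 → (2 : ℤ) ^ N ∣ t) (hg'M : ((2 : ℤ) ^ M') • g' = 0)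
    (hle : N - a - 1 ≤ M') (m n : ℤ) (hperp : B (m • g) (n • g') = 0)
    (hm : ¬ (2 : ℤ) ^ (a + 1) ∣ m) :
    ((2 : ℤ) ^ (M' - (N - a - 1))) • (n • g') = 0 := by
  rw [cross_pair] at hperp
  have hdiv : (2 : ℤ) ^ N ∣ m * n := hw _ hperp
  have hdiv' : (2 : ℤ) ^ N ∣ 2 * n * m := by
    have e : (2 : ℤ) * n * m = 2 * (m * n) := by ring
    rw [e]; exact dvd_mul_of_dvd_right hdiv 2
  exact smul_killed_of_two_pow_dvd g' M' (N - a - 1) hg'M hle n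
    (two_pow_dvd_of_dvd_two_mul a N n m hdiv' hm)

/-- Bridge: a `g'`-coordinate of large ORDER is not highly divisible — if `2^M' g' = 0`,
`j + 1 ≤ M'` and `2^(M'-j-1) • (n • g') ≠ 0`, then `2^(j+1) ∤ n`. -/
theorem not_two_pow_dvd_of_smul_ne_zero (g' : A) (M' j : ℕ) (hg'M : ((2 : ℤ) ^ M') • g' = 0)
    (hj : j + 1 ≤ M') (n : ℤ) (hn : ((2 : ℤ) ^ (M' - j - 1)) • (n • g') ≠ 0) :
    ¬ (2 : ℤ) ^ (j + 1) ∣ n := by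
  intro hd
  apply hn
  have e : M' - j - 1 = M' - (j + 1) := by omega
  rw [e]
  exact smul_killed_of_two_pow_dvd g' M' (j + 1) hg'M hj n hd

end Summit.BirchSwinnertonDyer.BirchSwinnertonDyer.Cruxes.KolyvaginBoundedDefectAtTwo.KolyvaginSwap.SignedRefill
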